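import Literature.MathematicalPhysics.QuantumFieldTheory.Balaban1983to89.Node00.CarriersB4
import Literature.MathematicalPhysics.QuantumFieldTheory.Balaban1983to89.Node00.CarriersB5
import Literature.MathematicalPhysics.QuantumFieldTheory.Balaban1983to89.Node00.CarriersB6

/-!
# NODE 00 (YM-PLAN Track A) — ROOT MODULE OF RECORD, STAGE 1: the carrier bundle of record `carriers₁ θ X` (B4 and B5 groups pinned),
# the STAGED world-of-record predicate `IsWorldOfRecord₁`, the DAG nodes N01 ∕ N02 at every world of record, and the ONE-LEVEL B6
# SPECIAL CASE (`IsWorldOfRecord₁OL → IsWorldOfRecord₁`, N03 there)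

NODE 00 = Bałaban's «objects of record» as Lean DEFINITIONS (YM-PLAN §2a): the carrier bundles `X Y Z V W` feeding the N-binding
`DagBinding.Upstream.ofPrintedAllXPN X Y Z V W` (b4 ↦ `DagDischargedII.B4LeafNN`, referee ruling G-ref1-32; every other leaf as in
`Upstream.ofPrintedAllXP`), the binding world `w₀` and the datum `D₀`.  They are delivered IN STAGES keyed to the nodes they unblock
(seat pub-ymgap-node00-def, scoping report `NODE00-SCOPING.md`); this module is the Stage-1 root: it imports the per-bundle modules
`Node00CarriersB4` ([Balaban1983RegularityDecay]), `Node00CarriersB5` ([Balaban1984PropagatorsI]), `Node00CarriersB6` ([Balaban1984PropagatorsII],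
ONE-LEVEL special case) and pins the B4 and B5 groups AT ONCE, under coherent parameters, in one bundle; the one-level B6 block is offered as a
SIDE predicate that implies the main one (§5), so that the multi-level `BlockData` of a later stage can refine `IsWorldOfRecord₁` without
contradicting anything pinned here.

## CONVENTIONS OF RECORD (binding for every `Node00*` module; the rulings in force at landing — leads' sitting 2026-08-24 ∕ R296 default moment —
## are cited by id on the node rows by the plan seat: Q-N00-1 path, Q-N00-2 carriers of record, Q-N00-4 family form, Q-N00-6 vacuity standard, Q-N00-7 b4 leaf form)

* BINDING: the worlds of record carry the N-binding `w.up P = Upstream.ofPrintedAllXPN X Y Z V W` (b4 in its `0 ≤ α < 1` form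
  `B4LeafNN`; the literal `B4.ThmPrinted` «∀ α < 1» is refuted as typed at α < 0, `DagDischargedII` node 16).  Node statements
  `Dag.<Bk>_main (DagBinding.leavesP w P)` are binding-agnostic and never change; which reading a node asserts is decided HERE by `w.up`.
* FAMILY FORM (P4′): «the» world of record is a FAMILY over admissible parameters `θ : Stage1Params` (flow, dimension, block size, windows,
  regularity constants, …); `IsWorldOfRecordₛ w` pins ONLY THE UPSTREAM BLOCK `w.up` (the construction `w.C` stays free until the Stage-5
  module defines Bałaban's renormalization-group machine) and is REFINED stage by stage: a later stage's predicate implies this one, so a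
  node discharged at Stage 1 stays discharged.  Two devices keep that implication one line long: (a) the bundles NOT yet pinned are
  quantified PER RUN — `∀ P, ∃ X Y Z V W, w.up P = ofPrintedAllXPN (carriers₁ θ X) Y Z V W` — because several later groups are run-indexed
  ([Balaban1985UV3] ∕ [Balaban1987RG1] ∕ [Balaban1988RG2Cluster] ∕ [Balaban1989LargeFieldI]); (b) a later stage pins a further group by
  substituting it INSIDE, `carriersₛ₊₁ θ X := carriersₛ θ (withBk X …)`, so `IsWorldOfRecordₛ₊₁ w → IsWorldOfRecordₛ w` is witnessed by
  `X ↦ withBk X …` (§5 is the first instance).  Only groups whose carriers are FINAL enter the main chain; provisional readings (the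
  one-level B6 block) are side predicates.
* VACUITY STANDARD (F3 ∕ Q-N00-6): a carrier group is pinned here only when EVERY field read by ANY conjunct of its leaf is the lineage's
  genuine object (no placeholder fields); the LOCATED READINGS under which the lineage's objects transcribe print are listed in the
  per-bundle module docstrings and are printed on the node rows by the plan seat — they are READINGS, adjudicated by the cross-readers
  and the referee, not by this file: B4 — abelian one-parameter flow (1.2) as printed, component fields, ℓ^∞ torus metric, `0` for
  distances to empty sets under the full-torus waiver, admissible torus contours, big-block size `Kmod` CHOSEN, general rectangular tori,
  lattice `ℤ^{(D−1)+1}` regions for Props. 2.3 ∕ 3.1′; B5 — top-level tori (re-indexing of the printed scale-`k` lattices), `U = 1` and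
  `m² = 0` as printed in [Balaban1984PropagatorsI]; B6 (§5 only) — the ONE-LEVEL knit block (`Hyp21_22 := True`, `R = M = 1`): a STRICT
  SUB-FAMILY of the printed multi-level geometries (2.1)–(2.2) = a SPECIAL CASE, recorded as such; physical dimension `D ≥ 2`, Bałaban's
  block size `L` odd `> 1` (print: `L` odd > 11 — compatible), B4's `ℓ := L − 1`.
* CONSTANTS (F4): structural parameters are fields of `θ`; constants print asserts to exist take the lineage's explicit admissible
  values where extracted; «sufficiently small ∕ large» thresholds keep the printed quantifier order inside the node statements.
* NOTHING OF BAŁABAN'S IS ASSERTED BEYOND PRINT: every theorem below is kernel bookkeeping over lit-balaban theorems cited BY NAME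
  (`B4LeafRegular.leafNN_torusPairFam`, `B5WalkRealisationTorus.prop11Printed_famG`, `B5Prop12GHolds.prop12_famG_printed`,
  `B5Bounds167Lattice.bounds167_formOfLatticeR`, `B6LeafB6OneLevelFamG.b6BlockParam_oneLevel_famG`); unproved printed results stay named
  `def … : Prop` hypotheses elsewhere in the tree, never axioms.  ONE FINITE FOUR-TORUS PROGRAMME AT FIXED ε ([Balaban1989LargeFieldII]
  Thm 1 scope): NOT the continuum limit on ℝ⁴, NOT infinite volume, NOT OS axioms, NOT a mass gap, NOT the Clay problem.

## WHAT THIS FILE DEFINES AND PROVES (0 sorry; axioms {propext, Classical.choice, Quot.sound})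

* §1 `Stage1Params` (the family parameters `θ`, with the four proof fields the DEFINITIONS need), `Stage1Params.Admissible` (the hypotheses the
  lineage THEOREMS need — printed on the node rows — followed by the two constraints of record `a₋ ≤ a ≤ a₊`, `0 ≤ m²₊` of pub-ymgap lead R302,
  items e1 ∕ e3), `Stage1Params.exists_admissible` (non-vacuity, `D = 4`); §2 `carriers₁B4 θ X` (B4 group of record substituted), `carriers₁ θ X :=
  withB5OfRecord (carriers₁B4 θ X) D L a` (the per-bundle substitutions COMPOSED — no parallel carrier copy), `carriers₁_b4 ∕ _b5` (the two
  leaves of the N-binding hold at `carriers₁ θ X` for admissible `θ`, any `X Y Z V W`);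
* §3 `IsWorldOfRecord₁ w` (STAGED world-of-record predicate, Stage 1), `isWorldOfRecord₁_of_up` (the constant-binding worlds
  `w.up = fun _ => ofPrintedAllXPN (carriers₁ θ X) Y Z V W` of YM-PLAN §2a qualify), `WorldP.withUp` + `isWorldOfRecord₁_withUp` (non-vacuity
  relative to any binding world);
* §4 `b4_main_of_isWorldOfRecord₁`, `b5_main_of_isWorldOfRecord₁` — the venue slots `YMDAG.N01_holds ∕ N02_holds` become one-liners over
  `hw : IsWorldOfRecord₁ w` (REPOINTING-TEMPLATE (A); shape `(w) (hw : IsWorldOfRecord₁ w) (P) : Dag.Bk_main (leavesP w P)`);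
* §5 `B6OneLevelParams`, `carriers₁OL θ ν X := carriers₁ θ (withB6OfRecord X D L a δ₀ m²′)`, `carriers₁OL_b6`, `IsWorldOfRecord₁OL`,
  `isWorldOfRecord₁_of_isWorldOfRecord₁OL` (the side predicate refines the main one), `b6_main_of_isWorldOfRecord₁OL` (N03 ON THE SPECIAL CASE),
  `nodes_N01_N02_N03_of_isWorldOfRecord₁OL`.
-/

noncomputable section

namespace Literature.MathematicalPhysics.QuantumFieldTheory.Balaban1983to89.Node00

open scoped Matrix
open DagBinding DagDischargedII B4GaugeCovariance

/-! ## §1. Stage-1 family parameters and admissibility -/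

/-- **Stage-1 family parameters `θ`** of the worlds of record: the colour index type `ι` (component fields, `N = |ι|`), the abelian
one-parameter orthogonal flow `F` of [Balaban1983RegularityDecay] (1.2) with a Lipschitz modulus `ℓ₁` (`‖(U(t) − 1)v‖ ≤ ℓ₁t‖v‖`), the
physical dimension `D`, Bałaban's block size `L` (odd, `> 1`), the weight windows `[a₋, a₊]`, `m²₊` (`a₋ > 0`), the (1.7)-regularity
constants `(c, β)`, Prop. 2.3's `a′`, Prop. 3.1′'s `(a, m², O(1), a₀, p)` (`a` is also the averaging weight of the [Balaban1984PropagatorsI] group)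
and the Sect. 5 Theorem's `(d₅, N₅)`.  The four PROOF fields are exactly what the DEFINITIONS consume (the big-block size `Kmod` is chosen from
them); the remaining hypotheses form `Stage1Params.Admissible`. [cite: Balaban1983RegularityDecay, (1.1)–(1.7) pp.572–573; Balaban1984PropagatorsI, (1.6) p.19 (parameter dictionary)] -/
structure Stage1Params where
  /-- colour index type (component fields `Site × ι → ℝ`) -/
  ι : Type
  [instFintype : Fintype ι]
  [instDecEq : DecidableEq ι]
  /-- the one-parameter orthogonal flow `t ↦ U(t) = e^{tq}` of (1.2) -/
  F : OrthFlow ι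
  /-- Lipschitz modulus of the flow -/
  ℓ₁ : ℝ
  hℓ₁ : 0 ≤ ℓ₁
  hLip : ∀ t (v : ι → ℝ), ((F.U t - 1) *ᵥ v) ⬝ᵥ ((F.U t - 1) *ᵥ v) ≤ (ℓ₁ * t) ^ 2 * (v ⬝ᵥ v)
  /-- physical dimension (B4's lattice is `ℤ^{(D−1)+1}`, B5 ∕ B6 use `d := D`) -/
  D : ℕ
  /-- Bałaban's block size -/
  L : ℕ
  hL : Odd L ∧ 1 < L
  /-- weight window `a_k ∈ [a₋, a₊]` and mass bound `m² ≤ m²₊` -/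
  amin : ℝ
  aplus : ℝ
  m2plus : ℝ
  ha : 0 < amin
  /-- (1.7)-regularity constants `(c, β)` -/
  creg : ℝ
  β : ℝ
  /-- Prop. 2.3's coefficient `a′` -/
  a' : ℝ
  /-- Prop. 3.1′'s `(a, m², O(1), a₀, p)`; `a` is also the averaging weight of the B5 (and one-level B6) groups -/
  a : ℝ
  m2 : ℝ
  C : ℝ
  a₀ : ℝ
  p : ℝ
  /-- the Sect. 5 Theorem's `(d, N)` -/
  d₅ : ℕ
  N₅ : ℕ

-- `Stage1Params.instFintype ∕ .instDecEq` are the instances CARRIED by the bundled colour type `θ.ι` — a field of `θ`, not a library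
-- type — so registering them cannot override a library instance (the device of `B6.Geometry.fin` in this directory).
attribute [instance] Stage1Params.instFintype Stage1Params.instDecEq

namespace Stage1Params

/-- **Admissibility of the Stage-1 parameters** — the hypotheses under which the lineages' theorems give the leaves (printed on the node
rows N01 ∕ N02): `D ≥ 2`, `a₋ ≤ a₊`, `c ≥ 0`, `β > 0`, `a′ > 0`, `a > 0`, `m² ≥ 0`, `O(1) ≥ 0`, `a₀ ≥ 0`, `p > 0`; followed by two constraints OF
RECORD that no lineage theorem consumes (pub-ymgap lead R302, cross-read items e1 ∕ e3): `a₋ ≤ a ≤ a₊` — ONE averaging weight: the weight `a` of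
Prop. 3.1′ and of the [Balaban1984PropagatorsI] ∕ one-level [Balaban1984PropagatorsII] groups lies in the B4 group's window `[a₋, a₊]` (print uses one
positive constant `a` close to 1, (1.6)) — and, LAST, `m²₊ ≥ 0` (print: `m² ≥ 0`, (1.6) p.572), WITHOUT which the two window-indexed B4 families of record
(`torusPairFam`, `regularFieldRegionsW`: index fields `0 ≤ m² ≤ m²₊`) are EMPTY and their leaf conjuncts vacuous (vacuity standard Q-N00-6;
`Node00NonVacuity.isEmpty_torusPairInst_of_neg`). [cite: Balaban1983RegularityDecay, (1.6) p.572, Theorem p.573, Props. 2.3 / 3.1′ p.574; Balaban1984PropagatorsI, (1.6) p.19, Props. 1.1–1.2 pp.33–36 (hypothesis dictionary)] -/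
def Admissible (θ : Stage1Params) : Prop :=
  2 ≤ θ.D ∧ θ.amin ≤ θ.aplus ∧ 0 ≤ θ.creg ∧ 0 < θ.β ∧ 0 < θ.a' ∧ 0 < θ.a ∧ 0 ≤ θ.m2 ∧ 0 ≤ θ.C ∧ 0 ≤ θ.a₀ ∧ 0 < θ.p ∧
    θ.amin ≤ θ.a ∧ θ.a ≤ θ.aplus ∧ 0 ≤ θ.m2plus

/-- `1 ≤ L − 1` for Bałaban's block size `L` odd `> 1` (B4's `ℓ := L − 1 ≥ 1`). [cite: Balaban1987RG1, p.253 «L an odd positive integer» (bookkeeping)] -/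
theorem one_le_pred (θ : Stage1Params) : 1 ≤ θ.L - 1 := by
  obtain ⟨⟨k, hk⟩, h1⟩ := θ.hL
  omega

/-- **NON-VACUITY of the parameter family**: admissible Stage-1 parameters exist in the physical dimension `D = 4` — e.g. `N = 2` component
fields with the rotation flow `OrthFlow.rot` of [Balaban1983RegularityDecay]'s (1.2) (Lipschitz modulus `1`, `B4Lower18Regular.rot_lipschitz`), block
size `L = 3`, unit windows and constants. [cite: Balaban1983RegularityDecay, (1.2) p.572 (the flow); Balaban1987RG1, p.253 (L odd) — bookkeeping witness] -/
theorem exists_admissible : ∃ θ : Stage1Params, θ.Admissible ∧ θ.D = 4 :=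
  ⟨{ ι := Fin 2, F := OrthFlow.rot, ℓ₁ := 1, hℓ₁ := zero_le_one, hLip := B4Lower18Regular.rot_lipschitz, D := 4, L := 3,
     hL := ⟨⟨1, rfl⟩, by norm_num⟩, amin := 1, aplus := 1, m2plus := 0, ha := one_pos, creg := 0, β := 1, a' := 1, a := 1, m2 := 0,
     C := 0, a₀ := 0, p := 1, d₅ := 4, N₅ := 2 },
    ⟨by norm_num, le_rfl, le_rfl, one_pos, one_pos, one_pos, le_rfl, le_rfl, le_rfl, one_pos, le_rfl, le_rfl, le_rfl⟩, rfl⟩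

end Stage1Params

/-! ## §2. The Stage-1 carrier bundle of record -/

/-- Intermediate bundle: the B4 group of record substituted (`withB4OfRecord` at `θ`'s flow, dimension `D − 1`, block `ℓ = L − 1`, windows and
constants). [cite: Balaban1983RegularityDecay, (1.1)–(1.7) pp.572–573 (the r01 lineage's concrete carriers)] -/
def carriers₁B4 (θ : Stage1Params) (X : PrintedCarriersR) : PrintedCarriersR :=
  withB4OfRecord θ.F θ.hℓ₁ θ.hLip (θ.D - 1) (θ.L - 1) θ.one_le_pred θ.amin θ.aplus θ.m2plus θ.ha θ.creg θ.β
    θ.a' θ.a θ.m2 θ.C θ.a₀ θ.p θ.d₅ θ.N₅ X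

/-- **The Stage-1 carrier bundle of record** `carriers₁ θ X`: the bundle `X` with its B4 group := the [Balaban1983RegularityDecay] objects
(`withB4OfRecord`: torus region pairs at a regular field, lattice `ℤ^{(D−1)+1}`, block `(L−1)+1 = L`, big blocks `Kmod`) and then its B5 group := the
[Balaban1984PropagatorsI] objects (`withB5OfRecord`: `G = Δ_a⁻¹` on the top-level tori, real unit-torus forms) — the per-bundle substitutions composed
through `carriers₁B4`; every other group of `X` (B6, B7, B8, B10, B12, B13, R-extension) unchanged. [cite: Balaban1983RegularityDecay, (1.1)–(1.7) pp.572–573; Balaban1984PropagatorsI, Props. 1.1–1.2 pp.33–36, (1.64)–(1.67) p.29 (the lineages' concrete carriers)] -/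
def carriers₁ (θ : Stage1Params) (X : PrintedCarriersR) : PrintedCarriersR :=
  withB5OfRecord (carriers₁B4 θ X) θ.D θ.L θ.a

section Leaves

variable (θ : Stage1Params) (hθ : θ.Admissible) (X : PrintedCarriersR) (Y : PrintedCarriers9X) (Z : PrintedCarriers11)
  (V : PrintedCarriers14R) (W : PrintedCarriers15)

include hθ in
/-- **Leaf `b4` of the N-binding at `carriers₁ θ X`** (admissible `θ`): `B4LeafNN` by `B4LeafRegular.leafNN_torusPairFam`, through
`b4N_withB4OfRecord` at `carriers₁B4 θ X` (the B5 substitution does not touch the B4 group; definitional unfolding). [cite: Balaban1983RegularityDecay, Theorem (1.9)–(1.12) p.573 (0 ≤ α form), Props. 2.3 / 3.1′ p.574, Sect. 5 Theorem p.594 (kernel versions of the lit-balaban r01 lineage)] -/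
theorem carriers₁_b4 : (Upstream.ofPrintedAllXPN (carriers₁ θ X) Y Z V W).b4 := by
  obtain ⟨_, hap, hcreg, hβ, ha', ha0, hm, hC, ha₀, hp, _⟩ := hθ
  exact b4N_withB4OfRecord θ.F θ.hℓ₁ θ.hLip (θ.D - 1) (θ.L - 1) θ.one_le_pred θ.amin θ.aplus θ.m2plus θ.ha hap
    θ.creg θ.β hcreg hβ θ.a' ha' θ.a θ.m2 θ.C θ.a₀ θ.p ha0 hm hC ha₀ hp θ.d₅ θ.N₅ X Y Z V W

include hθ in
/-- **Leaf `b5` at `carriers₁ θ X`**: `B5.MainBlock` by `b5_withB5OfRecord` (Prop. 1.1, Prop. 1.2, (1.67) of the lineages; the N-binding's `b5` is the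
X-binding's). [cite: Balaban1984PropagatorsI, Prop. 1.1 p.33, Prop. 1.2 pp.35–36, (1.67) p.29 (kernel versions of the lit-balaban lineages)] -/
theorem carriers₁_b5 : (Upstream.ofPrintedAllXPN (carriers₁ θ X) Y Z V W).b5 := by
  obtain ⟨hD, _, _, _, _, ha0, _⟩ := hθ
  exact b5_withB5OfRecord (carriers₁B4 θ X) Y Z V W (le_trans one_le_two hD) θ.hL ha0

end Leaves

/-! ## §3. The staged world-of-record predicate, Stage 1 -/

/-- **«`w` is a binding world of record, Stage 1»** (STAGED predicate, P4′): for SOME admissible family parameters `θ`, at EVERY run `P` the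
upstream block `w.up P` is the N-binding over a carrier bundle whose B4 and B5 groups are the Stage-1 objects of record (`carriers₁ θ X`) —
the other groups of `X` and the bundles `Y Z V W` still arbitrary (and allowed to depend on the run: they become «of record» in later stages,
several of them run-indexed); the construction `w.C` and the scalar fields of `w` are NOT constrained (Stage 5).
[cite: Balaban1983RegularityDecay, (1.1)–(1.7) pp.572–573; Balaban1984PropagatorsI, Props. 1.1–1.2 pp.33–36 (objects of record, Stage 1 dictionary)] -/
def IsWorldOfRecord₁ (w : WorldP) : Prop :=
  ∃ θ : Stage1Params, θ.Admissible ∧ ∀ P : B12.RunParams,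
    ∃ (X : PrintedCarriersR) (Y : PrintedCarriers9X) (Z : PrintedCarriers11) (V : PrintedCarriers14R) (W : PrintedCarriers15),
      w.up P = Upstream.ofPrintedAllXPN (carriers₁ θ X) Y Z V W

/-- The constant-binding worlds of YM-PLAN §2a («`w₀.up = fun _ => ofPrintedAllXPN X Y Z V W`») over the Stage-1 carriers of record are worlds
of record, Stage 1. [cite: Balaban1983RegularityDecay, (1.1)–(1.7) pp.572–573 (objects of record, bookkeeping)] -/
theorem isWorldOfRecord₁_of_up (θ : Stage1Params) (hθ : θ.Admissible) (X : PrintedCarriersR) (Y : PrintedCarriers9X)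
    (Z : PrintedCarriers11) (V : PrintedCarriers14R) (W : PrintedCarriers15) (w : WorldP)
    (hw : w.up = fun _ => Upstream.ofPrintedAllXPN (carriers₁ θ X) Y Z V W) : IsWorldOfRecord₁ w :=
  ⟨θ, hθ, fun P => ⟨X, Y, Z, V, W, by rw [hw]⟩⟩

/-- A binding world with its upstream block replaced (every scalar field and the construction kept). [folklore] -/
def WorldP.withUp (w : WorldP) (up : B12.RunParams → Upstream) : WorldP :=
  { w with up := up }

/-- **Non-vacuity relative to any binding world**: re-binding ANY world `w` to the N-binding over the Stage-1 carriers of record (admissible `θ`)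
gives a world of record, Stage 1. [cite: Balaban1983RegularityDecay, (1.1)–(1.7) pp.572–573 (objects of record, bookkeeping)] -/
theorem isWorldOfRecord₁_withUp (w : WorldP) (θ : Stage1Params) (hθ : θ.Admissible) (X : PrintedCarriersR) (Y : PrintedCarriers9X)
    (Z : PrintedCarriers11) (V : PrintedCarriers14R) (W : PrintedCarriers15) :
    IsWorldOfRecord₁ (WorldP.withUp w fun _ => Upstream.ofPrintedAllXPN (carriers₁ θ X) Y Z V W) :=
  isWorldOfRecord₁_of_up θ hθ X Y Z V W _ rfl

/-! ## §4. The DAG nodes N01, N02 at every world of record, Stage 1 -/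

/-- **N01 · [Balaban1983RegularityDecay]: `Dag.B4_main (leavesP w P)` at every world of record (Stage 1), every run** — the venue slot
`YMDAG.N01_holds` as a one-liner. [cite: Balaban1983RegularityDecay, Theorem p.573 (0 ≤ α form), Props. 2.3 / 3.1′ p.574, Sect. 5 Theorem p.594 (kernel versions of the lit-balaban r01 lineage)] -/
theorem b4_main_of_isWorldOfRecord₁ (w : WorldP) (hw : IsWorldOfRecord₁ w) (P : B12.RunParams) : Dag.B4_main (leavesP w P) := by
  obtain ⟨θ, hθ, hup⟩ := hw
  obtain ⟨X, Y, Z, V, W, hP⟩ := hup P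
  show (w.up P).b4
  rw [hP]
  exact carriers₁_b4 θ hθ X Y Z V W

/-- **N02 · [Balaban1984PropagatorsI]: `Dag.B5_main (leavesP w P)` («b4 → b5») at every world of record (Stage 1), every run** — the
antecedent is not used. [cite: Balaban1984PropagatorsI, Props. 1.1–1.2 pp.33–36, (1.67) p.29 (kernel versions of the lit-balaban lineages)] -/
theorem b5_main_of_isWorldOfRecord₁ (w : WorldP) (hw : IsWorldOfRecord₁ w) (P : B12.RunParams) : Dag.B5_main (leavesP w P) := by
  obtain ⟨θ, hθ, hup⟩ := hw
  obtain ⟨X, Y, Z, V, W, hP⟩ := hup P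
  intro _
  show (w.up P).b5
  rw [hP]
  exact carriers₁_b5 θ hθ X Y Z V W

/-- **N01 ∧ N02 at every world of record (Stage 1), every run** (venue forms `YMDAG.N01 ∕ N02 w P`). [cite: Balaban1983RegularityDecay, Theorem p.573; Balaban1984PropagatorsI, Props. 1.1–1.2 (kernel versions of the lit-balaban lineages)] -/
theorem nodes_N01_N02_of_isWorldOfRecord₁ (w : WorldP) (hw : IsWorldOfRecord₁ w) (P : B12.RunParams) :
    Dag.B4_main (leavesP w P) ∧ Dag.B5_main (leavesP w P) :=
  ⟨b4_main_of_isWorldOfRecord₁ w hw P, b5_main_of_isWorldOfRecord₁ w hw P⟩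

/-! ## §5. SIDE PREDICATE — the ONE-LEVEL B6 block (SPECIAL CASE of the printed multi-level geometries) and N03 there -/

/-- Parameters of the one-level knit block of [Balaban1984PropagatorsII] beyond `θ`: the decay rate `δ₀ > 0` and the mass `m²′ ≥ 0` of its `G′`
(the block's dimension `d := D`, block size `L` and weight `a` are `θ`'s). [cite: Balaban1984PropagatorsII, (2.1)–(2.2) p.224, Prop. 2.2 p.234 (parameter dictionary)] -/
structure B6OneLevelParams where
  δ₀ : ℝ
  msq : ℝ
  hδ : 0 < δ₀
  hmsq : 0 ≤ msq

/-- **The Stage-1 bundle with, IN ADDITION, the B6 block := the ONE-LEVEL knit block** `knitBlockG D L a δ₀ (blockGp D L a m²′)` — substituted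
INSIDE (`carriers₁ θ (withB6OfRecord X …)`), so that forgetting it recovers a Stage-1 bundle of record verbatim.  SPECIAL CASE: `Hyp21_22 := True`,
`R = M = 1` — a strict sub-family of the printed geometries (2.1)–(2.2). [cite: Balaban1984PropagatorsII, (2.1)–(2.2) p.224, Lemma 2.1 – Cor. 2.8 pp.234–249 (the r03 lineage's one-level carriers)] -/
def carriers₁OL (θ : Stage1Params) (ν : B6OneLevelParams) (X : PrintedCarriersR) : PrintedCarriersR :=
  carriers₁ θ (withB6OfRecord X θ.D θ.L θ.a ν.δ₀ ν.msq)

/-- **Leaf `b6` (parameter form) at `carriers₁OL θ ν X`** (admissible `θ`): `DagBinding.B6BlockParam` of the one-level knit block by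
`b6_withB6OfRecord` (the B4 ∕ B5 substitutions do not touch the B6 block; definitional unfolding). [cite: Balaban1984PropagatorsII, Lemma 2.1 – Cor. 2.8 pp.234–249 (kernel versions of the lit-balaban lineages, one level)] -/
theorem carriers₁OL_b6 (θ : Stage1Params) (hθ : θ.Admissible) (ν : B6OneLevelParams) (X : PrintedCarriersR) (Y : PrintedCarriers9X)
    (Z : PrintedCarriers11) (V : PrintedCarriers14R) (W : PrintedCarriers15) :
    (Upstream.ofPrintedAllXPN (carriers₁OL θ ν X) Y Z V W).b6 := by
  obtain ⟨hD, _, _, _, _, ha0, _⟩ := hθ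
  exact b6_withB6OfRecord X Y Z V W hD θ.hL ha0 ν.hδ ν.hmsq

/-- **«`w` is a binding world of record, Stage 1, ONE-LEVEL B6 READING»** (side predicate): as `IsWorldOfRecord₁` with, in addition, the B6 block
pinned to the one-level knit block.  Whether this reading may stand «of record» for N03 (whose consumers use the multi-level statements) is the
leads' ruling (plan P6 addendum: special case — third tally at best unless admitted); the multi-level `BlockData` of record refines
`IsWorldOfRecord₁`, not this predicate. [cite: Balaban1984PropagatorsII, (2.1)–(2.2) p.224 (objects of record, one-level reading, dictionary)] -/
def IsWorldOfRecord₁OL (w : WorldP) : Prop :=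
  ∃ (θ : Stage1Params) (ν : B6OneLevelParams), θ.Admissible ∧ ∀ P : B12.RunParams,
    ∃ (X : PrintedCarriersR) (Y : PrintedCarriers9X) (Z : PrintedCarriers11) (V : PrintedCarriers14R) (W : PrintedCarriers15),
      w.up P = Upstream.ofPrintedAllXPN (carriers₁OL θ ν X) Y Z V W

/-- **Refinement: the one-level side predicate implies the Stage-1 predicate** (witness `X ↦ withB6OfRecord X …`; `rfl`). [cite: Balaban1984PropagatorsII, (2.1)–(2.2) p.224 (bookkeeping)] -/
theorem isWorldOfRecord₁_of_isWorldOfRecord₁OL (w : WorldP) (hw : IsWorldOfRecord₁OL w) : IsWorldOfRecord₁ w := by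
  obtain ⟨θ, ν, hθ, hup⟩ := hw
  refine ⟨θ, hθ, fun P => ?_⟩
  obtain ⟨X, Y, Z, V, W, hP⟩ := hup P
  exact ⟨withB6OfRecord X θ.D θ.L θ.a ν.δ₀ ν.msq, Y, Z, V, W, hP⟩

/-- The constant-binding worlds over `carriers₁OL θ ν X` satisfy the side predicate. [cite: Balaban1984PropagatorsII, (2.1)–(2.2) p.224 (bookkeeping)] -/
theorem isWorldOfRecord₁OL_of_up (θ : Stage1Params) (hθ : θ.Admissible) (ν : B6OneLevelParams) (X : PrintedCarriersR)
    (Y : PrintedCarriers9X) (Z : PrintedCarriers11) (V : PrintedCarriers14R) (W : PrintedCarriers15) (w : WorldP)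
    (hw : w.up = fun _ => Upstream.ofPrintedAllXPN (carriers₁OL θ ν X) Y Z V W) : IsWorldOfRecord₁OL w :=
  ⟨θ, ν, hθ, fun P => ⟨X, Y, Z, V, W, by rw [hw]⟩⟩

/-- **N03 · [Balaban1984PropagatorsII]: `Dag.B6_main (leavesP w P)` («b4 → b5 → b6») at every world of the ONE-LEVEL B6 READING, every run** —
ON THE SPECIAL CASE (the antecedents are not used).  Shape `(w) (hw : IsWorldOfRecord₁OL w) (P) : Dag.B6_main (leavesP w P)`. [cite: Balaban1984PropagatorsII, Lemma 2.1 – Cor. 2.8 pp.234–249 (kernel versions of the lit-balaban lineages, one level)] -/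
theorem b6_main_of_isWorldOfRecord₁OL (w : WorldP) (hw : IsWorldOfRecord₁OL w) (P : B12.RunParams) : Dag.B6_main (leavesP w P) := by
  obtain ⟨θ, ν, hθ, hup⟩ := hw
  obtain ⟨X, Y, Z, V, W, hP⟩ := hup P
  intro _ _
  show (w.up P).b6
  rw [hP]
  exact carriers₁OL_b6 θ hθ ν X Y Z V W

/-- **N01 ∧ N02 ∧ N03 at every world of the one-level B6 reading, every run** (N01 ∕ N02 through the refinement to `IsWorldOfRecord₁`). [cite: Balaban1983RegularityDecay, Theorem p.573; Balaban1984PropagatorsI, Props. 1.1–1.2; Balaban1984PropagatorsII, Lemma 2.1 – Cor. 2.8 (kernel versions of the lit-balaban lineages)] -/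
theorem nodes_N01_N02_N03_of_isWorldOfRecord₁OL (w : WorldP) (hw : IsWorldOfRecord₁OL w) (P : B12.RunParams) :
    Dag.B4_main (leavesP w P) ∧ Dag.B5_main (leavesP w P) ∧ Dag.B6_main (leavesP w P) :=
  have hw₁ := isWorldOfRecord₁_of_isWorldOfRecord₁OL w hw
  ⟨b4_main_of_isWorldOfRecord₁ w hw₁ P, b5_main_of_isWorldOfRecord₁ w hw₁ P, b6_main_of_isWorldOfRecord₁OL w hw P⟩

end Literature.MathematicalPhysics.QuantumFieldTheory.Balaban1983to89.Node00

end
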